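import Summits.ResolutionOfSingularities.ResolutionOfSingularities.Theses.HomologicalConductor
import Literature.RingTheory.CohomologyAnnihilator.Localization
import HarnessLib.Audit
import HarnessLib

/-!
# [OURS · LADDER-RESOLUTION L1 · slot W5.1 · kill tests K5.1 / K5.1b] Closed-point locality of the cohomology
# annihilator and the zero-dimensional canonical tower (route `HomologicalConductor`, host item
# `Globalisation` stmt-ResolutionOfSingularities-16486)

Two OURS statements (campaign statements, `def … : Prop`, no proofs; filed `--supports` the host item;
they replace the ROLE of the crux docstring's sentence «ca is a quasi-coherent ideal SHEAF … so the
v-towers are the local rings at the centres of v on ONE normalised blow-up tower» — they are NOT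
statements of the manuscript under adjudication in cell res-hironaka and nothing here is attributed to
its author):

* `CaLocalAtClosedPoints p` — for every reduced finitely generated algebra `B` over a field of
  characteristic `p` and every MAXIMAL ideal `𝔪`, `ca(B_𝔪) = ca(B)·B_𝔪` on the tree's
  `Literature.RingTheory.CohomologyAnnihilator.cohomologyAnnihilator` ([IyengarTakahashi2014, Def. 2.1];
  `⊇` is Lemma 2.10(1), tree `map_cohomologyAnnihilator_le_of_isLocalization`). Known: TRUE when
  `Sing B` is finite (isolated singularities), TRUE on the cusp cylinder `y² = x³` (`p ∉ {2,3}`), the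
  Whitney umbrella (`p ≠ 2`), `A₂ × 𝔸¹` (`p ≠ 3`); FALSE if «maximal» is replaced by «prime»
  (`Theorems.Globalisation.Negative.caSheaf_false`). Open in general. Kill test K5.1b (cell res-hironaka,
  L/res-L1-k51/KILL-TEST-K5.1-k51.md).
* `GlobalisationZeroDim p` — `CaLocalAtClosedPoints p` together with the crux's antecedent restricted to
  ZERO-DIMENSIONAL valuation rings (residue field algebraic over `k`; their centres are closed points on
  every model, so by `CaLocalAtClosedPoints` the route's local towers ARE the local rings of the single
  canonical tower `X_{m+1} = NBl_{ca~}(X_m)`) implies `ResolutionInChar p`. The valuation-theoretic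
  antecedent is the `let`-telescope of `Theses/HomologicalConductor.lean` VERBATIM with one inserted
  hypothesis (every `t ∈ O` satisfies a non-zero polynomial over `k` modulo the maximal ideal of `O`).
  A proof (noetherian/Riemann–Zariski compactness + place extension; sketch in the K5.1 report §5) would
  show that the ca-canonicity lever of slot W5.1 is alive modulo `CaLocalAtClosedPoints`, independently of
  two-model patching; the tree's non-locality theorems (`caSheaf_false`, `a2Cylinder_certificate`) concern
  non-closed centres only.

## References
* S. B. Iyengar, R. Takahashi, *Annihilation of cohomology and strong generation of module categories*,
  IMRN 2016 (arXiv:1404.1476), Def. 2.1, Lemma 2.10, Thm. 5.4. [IyengarTakahashi2014]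
* O. Zariski, P. Samuel, *Commutative Algebra* II, Ch. VI §4 (extension of places), §17. [ZariskiSamuel1960]
-/

-- single-problem summit: the doubled namespace component `ResolutionOfSingularities` is forced
set_option linter.dupNamespace false

namespace Summit.ResolutionOfSingularities.ResolutionOfSingularities.Theorems

open Literature.RingTheory.CohomologyAnnihilator

/-- [OURS · L1 W5.1 · K5.1b] **Closed-point locality of the cohomology annihilator in characteristic
`p`**: for every field `k` of characteristic `p`, every reduced finitely generated commutative
`k`-algebra `B` and every maximal ideal `𝔪` of `B`, the cohomology annihilator of `B_𝔪` is the
extension of the cohomology annihilator of `B`, `ca(B_𝔪) = ca(B)·B_𝔪` (the inclusion `⊇` is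
[IyengarTakahashi2014, Lemma 2.10(1)]). Replaces the role of «ca is a quasi-coherent ideal sheaf» in
the docstring of `HomologicalConductor.Globalisation`; NOT a statement of the manuscript.
[cite: IyengarTakahashi2014, Lemma 2.10 (1) (the inclusion ⊇); stated as a question in cell res-hironaka, L/res-L1-k51/KILL-TEST-K5.1-k51.md §5] -/
@[conjecture] def CaLocalAtClosedPoints (p : ℕ) : Prop :=
  ∀ (k : Type) [Field k] [CharP k p] (B : Type) [CommRing B] [Algebra k B] [IsReduced B]
    [Algebra.FiniteType k B] (𝔪 : Ideal B) [𝔪.IsMaximal],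
    Ideal.map (algebraMap B (Localization.AtPrime 𝔪)) (cohomologyAnnihilator B) =
      cohomologyAnnihilator (Localization.AtPrime 𝔪)

/-- [OURS · L1 W5.1 · K5.1b] **Globalisation through the zero-dimensional canonical ca-tower**:
closed-point locality of `ca` together with valuative termination of the route's canonical tower
along every ZERO-DIMENSIONAL valuation ring `O` of every function field `K/k`, `char k = p`
(`O ⊇ k`, every `t ∈ O` algebraic over `k` modulo the maximal ideal of `O`; the tower is the
`let`-telescope of `Theses/HomologicalConductor.lean` verbatim) implies resolution in characteristic
`p`. Replaces the role of the sentence «so the v-towers are the local rings at the centres of v on ONE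
normalised blow-up tower» of the crux docstring; NOT a statement of the manuscript.
[cite: ZariskiSamuel1960, Ch. VI §4 (extension of places) and §17 (centres); stated in cell res-hironaka, L/res-L1-k51/KILL-TEST-K5.1-k51.md §5] -/
@[conjecture] def GlobalisationZeroDim (p : ℕ) : Prop :=
  CaLocalAtClosedPoints p →
    (∀ (k K : Type) [Field k] [CharP k p] [Field K] [Algebra k K] (O : ValuationSubring K) (A : Subalgebra k K), (∀ c : k, algebraMap k K c ∈ O) → A.FG → IsFractionRing ↥A K → A.toSubring ≤ O.toSubring → (∀ t : K, t ∈ O → ∃ f : Polynomial k, f ≠ 0 ∧ (Polynomial.aeval t f = 0 ∨ (Polynomial.aeval t f)⁻¹ ∉ O)) → let ca : Subalgebra k K → Set K := fun A => {x : K | ∃ hx : x ∈ A, ∃ n : ℕ, ∀ i : ℕ, n ≤ i → ∀ (M N : ModuleCat.{0} ↥A), Module.Finite ↥A M → Module.Finite ↥A N → ∀ e : CategoryTheory.Abelian.Ext.{0} M N i, (⟨x, hx⟩ : ↥A) • e = 0}; let loc : Subalgebra k K → Subalgebra k K := fun A => Algebra.adjoin k {y : K | ∃ a ∈ A, ∃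 s ∈ A, s⁻¹ ∈ O ∧ y = a * s⁻¹}; let chart : Subalgebra k K → Subalgebra k K := fun A => Algebra.adjoin k ((A : Set K) ∪ {y : K | ∃ c ∈ ca A, ∃ x ∈ ca A, x ≠ 0 ∧ (∀ c' ∈ ca A, c' * x⁻¹ ∈ O) ∧ y = c * x⁻¹}); let nrm : Subalgebra k K → Subalgebra k K := fun B => Algebra.adjoin k {y : K | IsIntegral ↥B y}; let tower : Subalgebra k K → ℕ → Subalgebra k K := fun A m => @Nat.rec (fun _ => Subalgebra k K) (loc A) (fun _ B => loc (nrm (chart B))) m; ∃ m : ℕ, IsRegularLocalRing ↥(tower A m)) →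
      Literature.AlgebraicGeometry.Resolution.ResolutionInChar.{0} p

end Summit.ResolutionOfSingularities.ResolutionOfSingularities.Theorems
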